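import Mathlib
import Literature.RepresentationTheory.FiniteGroups.CharacterDegrees
import Literature.RepresentationTheory.FiniteGroups.NonabelianCharDegree
import Literature.Barriers.MatrixMultiplication.QuasirandomBarrier
import Summits.MatrixMultiplication.MatrixMultiplication.Theorems.GradedDesignFamily.Negative.SL2Generators
import Summits.MatrixMultiplication.MatrixMultiplication.Theorems.GradedDesignFamily.Negative.SubgroupHorn

/-!
# Minimal degree from a root datum `u : K → G`, `t : Kˣ → G`; the Borel of `SL₂(K)` and the Borel horn
# (negative-side support for `stub_subfieldCell`, crux `GradedDesignFamily`, stmt-MatrixMultiplication-7610)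

The torus-orbit argument of `Negative/SL2MinDegree.lean`, made GENERIC (`rootDatum_card_sub_one_le_two_mul`):
for any group `G` with `u : K → G` (`u_x u_y = u_{x+y}`), `t : Kˣ → G` (`t_c u_x = u_{c²x} t_c`) over a
finite field `K` and any irreducible complex `ρ` that is at most one-dimensional once all `u_x` act
trivially, `dim ρ > 1 ⟹ |K| − 1 ≤ 2 dim ρ` (operators `E_a = Σ_x ψ(−a x) ρ(u_x)` for a primitive additive
character, their relations, and the `t`-orbit count, verbatim as for `SL₂`).
Application to the BOREL of `SL₂(K)` — any subgroup `M` of upper-triangular matrices containing all `u_x`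
and `t_c`: if `U` acts trivially, all `ρ(m) = ρ(t_c)` commute and are scalars by Schur, so `ρ` is a line;
hence `|K| − 1 ≤ 2d` for every irreducible degree `d > 1` (`borel_card_sub_one_le_two_mul_of_mem_charDegrees`),
`n(M) ≥ (|K|−1)/2` for `|K| ≥ 4` (`borel_secondCharDegree_ge`; for `|K| ≤ 3` the Borel is abelian), and, with
`Negative/SubgroupHorn.lean`, the BOREL HORN of `stub_subfieldCell` is capped: a TPP triple `(X, Y, Z)` of
`SL₂(K)` with `X ⊆ B(K)` and `Y`, `Z` in right `B(K)`-cosets has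
`|X||Y||Z| ≤ √2·|B(K)|^{3/2}/√(|K|−1) + |B(K)| ≈ √2·|K|^{5/2}` (`borelHorn_card_mul_le`).
Sorry-free; axioms `propext`, `Classical.choice`, `Quot.sound`.
-/

set_option linter.dupNamespace false

noncomputable section

open scoped BigOperators
open Module Literature.RepresentationTheory.FiniteGroups Literature.Barriers.MatrixMultiplication

namespace Summit.MatrixMultiplication.MatrixMultiplication.Theorems.GradedDesignFamily.Negative

section RootDatum

variable {K : Type} [Field K] [Fintype K]
variable {G : Type} [Group G] (u : K → G) (t : Kˣ → G)
variable {V : Type} [AddCommGroup V] [Module ℂ V]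

/-- `ρ(u_y) E_a = ψ(a y) E_a` (reindex `x ↦ y + x`). [folklore] -/
theorem rootDatum_u_mul_E (hu : ∀ x y : K, u x * u y = u (x + y)) (ρ : Representation ℂ G V)
    (ψ : AddChar K ℂ) (a y : K) :
    ρ (u y) * (∑ x : K, ψ (-(a * x)) • ρ (u x)) = ψ (a * y) • ∑ x : K, ψ (-(a * x)) • ρ (u x) := by
  rw [Finset.mul_sum, Finset.smul_sum]
  refine Fintype.sum_equiv (Equiv.addLeft y) _ _ fun x => ?_
  simp only [Equiv.coe_addLeft, mul_smul_comm]
  rw [← map_mul, hu, smul_smul, ← AddChar.map_add_eq_mul]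
  congr 2
  ring

omit [Fintype K] in
/-- `u_0 = 1` (from `u_0 u_0 = u_0`). [folklore] -/
theorem rootDatum_u_zero (hu : ∀ x y : K, u x * u y = u (x + y)) : u 0 = 1 := by
  have h := hu 0 0
  rw [add_zero] at h
  exact mul_left_cancel (h.trans (mul_one _).symm)

/-- `Σ_a E_a = |K| • 1`. [folklore] -/
theorem rootDatum_sum_E (hu : ∀ x y : K, u x * u y = u (x + y)) (ρ : Representation ℂ G V)
    {ψ : AddChar K ℂ} (hψ : ψ.IsPrimitive) :
    ∑ a : K, ∑ x : K, ψ (-(a * x)) • ρ (u x) = (Fintype.card K : ℂ) • (1 : V →ₗ[ℂ] V) := by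
  classical
  rw [Finset.sum_comm]
  have : ∀ x : K, ∑ a : K, ψ (-(a * x)) • ρ (u x) =
      (if x = 0 then (Fintype.card K : ℂ) else 0) • ρ (u x) := by
    intro x
    rw [← Finset.sum_smul]
    congr 1
    have h := sl2md_sum_shift hψ (-x)
    simp only [neg_eq_zero] at h
    rw [← h]
    exact Finset.sum_congr rfl fun a _ => by rw [mul_neg]
  simp only [this, ite_smul, zero_smul, Finset.sum_ite_eq', Finset.mem_univ, if_true]
  rw [rootDatum_u_zero u hu, map_one]

/-- `E_a E_b = |K|·[a = b]·E_b`. [folklore] -/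
theorem rootDatum_E_mul_E [DecidableEq K] (hu : ∀ x y : K, u x * u y = u (x + y))
    (ρ : Representation ℂ G V) {ψ : AddChar K ℂ} (hψ : ψ.IsPrimitive) (a b : K) :
    (∑ x : K, ψ (-(a * x)) • ρ (u x)) * (∑ x : K, ψ (-(b * x)) • ρ (u x)) =
      (if a = b then (Fintype.card K : ℂ) else 0) • ∑ x : K, ψ (-(b * x)) • ρ (u x) := by
  rw [Finset.sum_mul]
  simp only [smul_mul_assoc, rootDatum_u_mul_E u hu, smul_smul]
  rw [← Finset.sum_smul]
  congr 1
  have h := sl2md_sum_shift hψ (b - a)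
  have hab : (b - a = 0) ↔ (a = b) := by rw [sub_eq_zero]; exact eq_comm
  simp only [hab] at h
  rw [← h]
  refine Finset.sum_congr rfl fun x _ => ?_
  rw [← AddChar.map_add_eq_mul]
  congr 1; ring

/-- The torus permutes the `E_a`: `ρ(t_c) E_a = E_{a c⁻²} ρ(t_c)`. [folklore] -/
theorem rootDatum_t_mul_E (ht : ∀ (c : Kˣ) (x : K), t c * u x = u ((c : K) * c * x) * t c)
    (ρ : Representation ℂ G V) (ψ : AddChar K ℂ) (a : K) (c : Kˣ) :
    ρ (t c) * (∑ x : K, ψ (-(a * x)) • ρ (u x)) =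
      (∑ x : K, ψ (-(a * ((c : K) * c)⁻¹ * x)) • ρ (u x)) * ρ (t c) := by
  rw [Finset.mul_sum, Finset.sum_mul]
  have hcc : ((c : K) * c) ≠ 0 := mul_ne_zero c.ne_zero c.ne_zero
  refine Fintype.sum_bijective (fun x => (c : K) * c * x) (mulLeft_bijective₀ _ hcc) _ _ fun x => ?_
  simp only [mul_smul_comm, smul_mul_assoc]
  rw [← map_mul, ht, map_mul]
  have hx : a * ((c : K) * c)⁻¹ * ((c : K) * c * x) = a * x := by field_simp
  rw [hx]

/-- **Minimal degree from a root datum.**  `G` a group with `u : K → G`, `t : Kˣ → G` as above over a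
finite field; `ρ` an irreducible complex representation of `G` which is at most one-dimensional whenever
all `u_x` act trivially.  If `dim ρ > 1` then `|K| − 1 ≤ 2 dim ρ`. [folklore] -/
theorem rootDatum_card_sub_one_le_two_mul (hu : ∀ x y : K, u x * u y = u (x + y))
    (ht : ∀ (c : Kˣ) (x : K), t c * u x = u ((c : K) * c * x) * t c)
    [FiniteDimensional ℂ V] (ρ : Representation ℂ G V)
    (htriv : (∀ x : K, ρ (u x) = 1) → finrank ℂ V ≤ 1) (hd : 1 < finrank ℂ V) :
    Fintype.card K - 1 ≤ 2 * finrank ℂ V := by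
  classical
  obtain ⟨ψ, hψ⟩ := sl2md_exists_isPrimitive (K := K)
  set E : K → (V →ₗ[ℂ] V) := fun a => ∑ x : K, ψ (-(a * x)) • ρ (u x) with hE
  have hq : (Fintype.card K : ℂ) ≠ 0 := Nat.cast_ne_zero.2 Fintype.card_ne_zero
  by_cases hcase : ∀ a : K, a ≠ 0 → E a = 0
  · -- all `u_x` act trivially: contradiction with `dim > 1`
    exfalso
    have hsum : E 0 = (Fintype.card K : ℂ) • (1 : V →ₗ[ℂ] V) := by
      rw [← rootDatum_sum_E u hu ρ hψ, Finset.sum_eq_single (0 : K)]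
      · intro a _ ha; exact hcase a ha
      · intro h; exact absurd (Finset.mem_univ _) h
    have hU : ∀ y : K, ρ (u y) = 1 := by
      intro y
      have h := rootDatum_u_mul_E u hu ρ ψ 0 y
      change ρ (u y) * E 0 = ψ (0 * y) • E 0 at h
      rw [zero_mul, AddChar.map_zero_eq_one, one_smul, hsum, mul_smul_comm, mul_one] at h
      exact smul_right_injective (V →ₗ[ℂ] V) hq h
    have := htriv hU
    omega
  · push Not at hcase
    obtain ⟨a₀, ha₀, hEa₀⟩ := hcase
    have horbit : ∀ c : Kˣ, E (a₀ * ((c : K) * c)⁻¹) ≠ 0 := by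
      intro c hzero
      apply hEa₀
      have h := rootDatum_t_mul_E u t ht ρ ψ a₀ c
      change ρ (t c) * E a₀ = E (a₀ * ((c : K) * c)⁻¹) * ρ (t c) at h
      rw [hzero, zero_mul] at h
      have hinv : ρ ((t c)⁻¹) * ρ (t c) = 1 := by rw [← map_mul, inv_mul_cancel, map_one]
      calc E a₀ = (ρ ((t c)⁻¹) * ρ (t c)) * E a₀ := by rw [hinv, one_mul]
        _ = ρ ((t c)⁻¹) * (ρ (t c) * E a₀) := by rw [mul_assoc]
        _ = 0 := by rw [h, mul_zero]
    set orb : Finset K := Finset.univ.image (fun c : Kˣ => a₀ * ((c : K) * c)⁻¹) with horb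
    have hne : ∀ b ∈ orb, ∃ w : V, E b w ≠ 0 := by
      intro b hb
      obtain ⟨c, -, rfl⟩ := Finset.mem_image.1 hb
      by_contra hall
      push Not at hall
      exact horbit c (LinearMap.ext hall)
    choose! w hw using hne
    have hli : LinearIndependent ℂ (fun b : orb => E b.1 (w b.1)) := by
      rw [linearIndependent_iff']
      intro s g hsum i hi
      have hEE : ∀ j : orb, E i.1 * E j.1 =
          (if i.1 = j.1 then (Fintype.card K : ℂ) else 0) • E j.1 :=
        fun j => rootDatum_E_mul_E u hu ρ hψ i.1 j.1
      have happly := congrArg (E i.1) hsum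
      rw [map_sum, map_zero] at happly
      have hterm : ∀ j ∈ s, E i.1 (g j • E j.1 (w j.1)) =
          if j = i then (g i * (Fintype.card K : ℂ)) • E i.1 (w i.1) else 0 := by
        intro j _
        rw [map_smul, ← Module.End.mul_apply, hEE j, LinearMap.smul_apply]
        by_cases hij : j = i
        · subst hij
          rw [if_pos rfl, if_pos rfl, smul_smul]
        · have hne : i.1 ≠ j.1 := fun h => hij (Subtype.ext h).symm
          rw [if_neg hne, if_neg hij, zero_smul, smul_zero]
      rw [Finset.sum_congr rfl hterm, Finset.sum_ite_eq' s i, if_pos hi] at happly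
      rcases smul_eq_zero.1 happly with h0 | h0
      · exact (mul_eq_zero.1 h0).resolve_right hq
      · exact absurd h0 (hw i.1 i.2)
    have hcard_le : orb.card ≤ finrank ℂ V := by
      have := hli.fintype_card_le_finrank
      rwa [Fintype.card_coe] at this
    have hfib : ∀ b ∈ orb, (Finset.univ.filter (fun c : Kˣ => a₀ * ((c : K) * c)⁻¹ = b)).card ≤ 2 := by
      intro b hb
      obtain ⟨c₀, -, rfl⟩ := Finset.mem_image.1 hb
      have hsub : (Finset.univ.filter (fun c : Kˣ => a₀ * ((c : K) * c)⁻¹ = a₀ * ((c₀ : K) * c₀)⁻¹)) ⊆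
          {c₀, -c₀} := by
        intro c hc
        rw [Finset.mem_filter] at hc
        have h := hc.2
        rw [mul_right_inj' ha₀, inv_inj] at h
        have h' : ((c : K) - c₀) * ((c : K) + c₀) = 0 := by linear_combination h
        rcases mul_eq_zero.1 h' with h1 | h1
        · rw [Finset.mem_insert]; left
          exact Units.ext (sub_eq_zero.1 h1)
        · rw [Finset.mem_insert, Finset.mem_singleton]; right
          apply Units.ext; rw [Units.val_neg]; linear_combination h1
      calc (Finset.univ.filter (fun c : Kˣ => a₀ * ((c : K) * c)⁻¹ = a₀ * ((c₀ : K) * c₀)⁻¹)).card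
          ≤ ({c₀, -c₀} : Finset Kˣ).card := Finset.card_le_card hsub
        _ ≤ 2 := Finset.card_le_two
    have hunits : Fintype.card Kˣ ≤ 2 * orb.card := by
      have := Finset.card_le_mul_card_image (Finset.univ : Finset Kˣ) 2 hfib
      rwa [Finset.card_univ] at this
    rw [Fintype.card_units] at hunits
    omega

end RootDatum

/-! ## The Borel subgroup of `SL₂(K)` -/
section Borel

variable {K : Type} [Field K] [Fintype K]

omit [Fintype K] in
/-- `t_c = diag(c, c⁻¹) ∈ SL₂(K)` times `u_x`: an upper-triangular matrix `[[a,b],[0,a⁻¹]]` is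
`t_a u_{b/a}`. [folklore] -/
theorem borel_eq_diag_mul_upper (g : Matrix.SpecialLinearGroup (Fin 2) K)
    (hg : (g : Matrix (Fin 2) (Fin 2) K) 1 0 = 0) :
    ∃ (c : Kˣ) (x : K), g = ⟨_, sl2md_det_diag c⟩ * ⟨_, sl2md_det_upper x⟩ := by
  set A := (g : Matrix (Fin 2) (Fin 2) K) 0 0 with hA
  set B := (g : Matrix (Fin 2) (Fin 2) K) 0 1 with hB
  set D := (g : Matrix (Fin 2) (Fin 2) K) 1 1 with hD
  have hdet : A * D = 1 := by
    have := g.prop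
    rw [Matrix.det_fin_two, hg, mul_zero, sub_zero] at this
    exact this
  have hA0 : A ≠ 0 := fun h => by rw [h, zero_mul] at hdet; exact zero_ne_one hdet
  refine ⟨Units.mk0 A hA0, B / A, ?_⟩
  refine Matrix.SpecialLinearGroup.ext _ _ fun i j => ?_
  rw [Matrix.SpecialLinearGroup.coe_mul]
  fin_cases i <;> fin_cases j
  · simp [Matrix.mul_apply, Fin.sum_univ_two, ← hA]
  · simp [Matrix.mul_apply, Fin.sum_univ_two, ← hB]
    field_simp
  · simp [Matrix.mul_apply, Fin.sum_univ_two, hg]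
  · simp [Matrix.mul_apply, Fin.sum_univ_two, ← hD]
    field_simp
    linear_combination hdet

/-- **Degrees of the Borel of `SL₂(K)`**: for any subgroup `M ≤ SL₂(K)` of upper-triangular matrices
containing all `u_x` and all `t_c` (so `M` is the Borel subgroup), every irreducible degree `d > 1`
satisfies `|K| − 1 ≤ 2d`.  (If `U` acts trivially then all `ρ(m) = ρ(t_c)` commute, so each is a scalar
by Schur's lemma and `ρ` is one-dimensional; otherwise the root-datum count applies.) [folklore] -/
theorem borel_card_sub_one_le_two_mul_of_mem_charDegrees
    (M : Subgroup (Matrix.SpecialLinearGroup (Fin 2) K))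
    (hM : ∀ g ∈ M, (g : Matrix (Fin 2) (Fin 2) K) 1 0 = 0)
    (hU : ∀ x : K, (⟨_, sl2md_det_upper x⟩ : Matrix.SpecialLinearGroup (Fin 2) K) ∈ M)
    (hT : ∀ c : Kˣ, (⟨_, sl2md_det_diag c⟩ : Matrix.SpecialLinearGroup (Fin 2) K) ∈ M) :
    ∀ d ∈ charDegrees M, 1 < d → Fintype.card K - 1 ≤ 2 * d := by
  classical
  rintro d ⟨V, _, _, _, ρ, hρ, rfl⟩ hd
  haveI := hρ
  -- the root datum of `M`
  let u : K → M := fun x => ⟨_, hU x⟩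
  let t : Kˣ → M := fun c => ⟨_, hT c⟩
  have hu : ∀ x y : K, u x * u y = u (x + y) := fun x y => Subtype.ext (sl2md_upper_mul x y)
  have ht : ∀ (c : Kˣ) (x : K), t c * u x = u ((c : K) * c * x) * t c :=
    fun c x => Subtype.ext (sl2md_diag_mul_upper c x)
  refine rootDatum_card_sub_one_le_two_mul u t hu ht ρ ?_ hd
  -- if `U` acts trivially, `ρ` is one-dimensional
  intro htrivU
  have hcomm : ∀ m m' : M, ρ m * ρ m' = ρ m' * ρ m := by
    have key : ∀ m : M, ∃ c : Kˣ, ρ m = ρ (t c) := by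
      intro m
      obtain ⟨c, x, hcx⟩ := borel_eq_diag_mul_upper m.1 (hM m.1 m.2)
      refine ⟨c, ?_⟩
      have : m = t c * u x := Subtype.ext hcx
      rw [this, map_mul, htrivU x, mul_one]
    intro m m'
    obtain ⟨c, hc⟩ := key m
    obtain ⟨c', hc'⟩ := key m'
    rw [hc, hc', ← map_mul, ← map_mul]
    congr 1
    apply Subtype.ext
    change (⟨_, sl2md_det_diag c⟩ * ⟨_, sl2md_det_diag c'⟩ : Matrix.SpecialLinearGroup (Fin 2) K) =
      ⟨_, sl2md_det_diag c'⟩ * ⟨_, sl2md_det_diag c⟩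
    refine Matrix.SpecialLinearGroup.ext _ _ fun i j => ?_
    rw [Matrix.SpecialLinearGroup.coe_mul, Matrix.SpecialLinearGroup.coe_mul]
    fin_cases i <;> fin_cases j <;> simp [Matrix.mul_apply, Fin.sum_univ_two, mul_comm]
  -- each `ρ m` is an intertwining self-map, hence a scalar (Schur)
  have hscalar : ∀ m : M, ∃ c : ℂ, ρ m = c • (1 : V →ₗ[ℂ] V) := by
    intro m
    let T : ρ.IntertwiningMap ρ := ⟨ρ m, fun g => by
      rw [← Module.End.mul_eq_comp, ← Module.End.mul_eq_comp, hcomm]⟩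
    obtain ⟨c, hc⟩ := (Representation.IsIrreducible.algebraMap_intertwiningMap_bijective_of_isAlgClosed
      (ρ := ρ)).2 T
    refine ⟨c, LinearMap.ext fun v => ?_⟩
    have h := congrArg (fun f : ρ.IntertwiningMap ρ => (f : V → V) v) hc
    simp only [Representation.IntertwiningMap.algebraMap_apply, Representation.IntertwiningMap.coe_smul,
      Representation.IntertwiningMap.coe_one, Pi.smul_apply] at h
    rw [LinearMap.smul_apply, Module.End.one_apply]
    exact h.symm
  -- so every line is a subrepresentation, and irreducibility forces `dim ≤ 1`
  by_contra hlt
  push Not at hlt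
  have hV : Nontrivial V := Module.nontrivial_of_finrank_pos (R := ℂ) (by omega)
  obtain ⟨v, hv⟩ := exists_ne (0 : V)
  let W : Subrepresentation ρ :=
    ⟨Submodule.span ℂ {v}, fun g w hw => by
      obtain ⟨c, hc⟩ := hscalar g
      rw [hc, LinearMap.smul_apply, Module.End.one_apply]
      exact Submodule.smul_mem _ c hw⟩
  have hWtop : W = ⊤ := by
    rcases IsSimpleOrder.eq_bot_or_eq_top W with h | h
    · exfalso
      have hmem : v ∈ W.toSubmodule := Submodule.mem_span_singleton_self v
      have hbot : W.toSubmodule = (⊥ : Subrepresentation ρ).toSubmodule := by rw [h]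
      rw [hbot] at hmem
      exact hv ((Submodule.mem_bot ℂ).1 hmem)
    · exact h
  have hspan : Submodule.span ℂ {v} = (⊤ : Subrepresentation ρ).toSubmodule := by rw [← hWtop]
  have h1 : finrank ℂ V = 1 := by
    rw [← finrank_top, ← show Submodule.span ℂ {v} = (⊤ : Submodule ℂ V) from hspan,
      finrank_span_singleton hv]
  omega

/-- For `|K| ≥ 4` the Borel of `SL₂(K)` is nonabelian: `t_c u_1 ≠ u_1 t_c` for any unit with `c² ≠ 1`.
[folklore] -/
theorem borel_nonabelian (M : Subgroup (Matrix.SpecialLinearGroup (Fin 2) K))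
    (hU : ∀ x : K, (⟨_, sl2md_det_upper x⟩ : Matrix.SpecialLinearGroup (Fin 2) K) ∈ M)
    (hT : ∀ c : Kˣ, (⟨_, sl2md_det_diag c⟩ : Matrix.SpecialLinearGroup (Fin 2) K) ∈ M)
    (hK : 4 ≤ Fintype.card K) : ∃ a b : M, a * b ≠ b * a := by
  classical
  -- a unit `c` with `c * c ≠ 1`: at most two units square to `1`, and `|Kˣ| ≥ 3`
  have hex : ∃ c : Kˣ, (c : K) * c ≠ 1 := by
    by_contra hall
    push Not at hall
    have hsub : (Finset.univ : Finset Kˣ) ⊆ {1, -1} := by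
      intro c _
      have h := hall c
      have h' : ((c : K) - 1) * ((c : K) + 1) = 0 := by linear_combination h
      rcases mul_eq_zero.1 h' with h1 | h1
      · rw [Finset.mem_insert]; left; exact Units.ext (by rw [Units.val_one]; linear_combination h1)
      · rw [Finset.mem_insert, Finset.mem_singleton]; right
        exact Units.ext (by rw [Units.val_neg, Units.val_one]; linear_combination h1)
    have hcard := Finset.card_le_card hsub
    rw [Finset.card_univ, Fintype.card_units] at hcard
    have h2 : ({1, -1} : Finset Kˣ).card ≤ 2 := Finset.card_le_two
    omega
  obtain ⟨c, hc⟩ := hex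
  refine ⟨⟨_, hT c⟩, ⟨_, hU 1⟩, fun h => hc ?_⟩
  have h' := congrArg (fun m : M => ((m : Matrix.SpecialLinearGroup (Fin 2) K) : Matrix (Fin 2) (Fin 2) K) 0 1) h
  simp [Matrix.mul_apply, Fin.sum_univ_two] at h'
  -- `h' : c = c⁻¹`-type relation; conclude `c * c = 1`
  have hc0 : (c : K) ≠ 0 := c.ne_zero
  field_simp at h'
  linear_combination h'

/-- **`n(B(K)) ≥ (|K|−1)/2`** for the Borel of `SL₂(K)`, `|K| ≥ 4`. [folklore] -/
theorem borel_secondCharDegree_ge (M : Subgroup (Matrix.SpecialLinearGroup (Fin 2) K))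
    (hM : ∀ g ∈ M, (g : Matrix (Fin 2) (Fin 2) K) 1 0 = 0)
    (hU : ∀ x : K, (⟨_, sl2md_det_upper x⟩ : Matrix.SpecialLinearGroup (Fin 2) K) ∈ M)
    (hT : ∀ c : Kˣ, (⟨_, sl2md_det_diag c⟩ : Matrix.SpecialLinearGroup (Fin 2) K) ∈ M)
    (hK : 4 ≤ Fintype.card K) :
    ((Fintype.card K : ℝ) - 1) / 2 ≤ secondCharDegree M := by
  classical
  have hne : {d : ℕ | d ∈ charDegrees M ∧ 1 < d}.Nonempty := by
    obtain ⟨d, hd, h1⟩ := Serre1977_thm9.exists_one_lt_mem_charDegrees Serre1977_thm9_holds M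
      (borel_nonabelian M hU hT hK)
    exact ⟨d, hd, h1⟩
  have hmem := Nat.sInf_mem hne
  have hmem' : secondCharDegree M ∈ charDegrees M ∧ 1 < secondCharDegree M := hmem
  have h := borel_card_sub_one_le_two_mul_of_mem_charDegrees M hM hU hT _ hmem'.1 hmem'.2
  have h1 : 1 ≤ Fintype.card K := Fintype.card_pos
  have hcast : ((Fintype.card K - 1 : ℕ) : ℝ) = (Fintype.card K : ℝ) - 1 := by
    rw [Nat.cast_sub h1, Nat.cast_one]
  have h' : ((Fintype.card K : ℝ) - 1) ≤ 2 * (secondCharDegree M : ℝ) := by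
    rw [← hcast]; exact_mod_cast h
  linarith

/-- **The Borel horn of `stub_subfieldCell` is capped.**  For the Borel `M = B(K)` of `SL₂(K)` (`|K| ≥ 4`)
and a TPP triple `(X, Y, Z)` of `SL₂(K)` with `X ⊆ M` and `Y`, `Z` each in one right `M`-coset:
`|X||Y||Z| ≤ √2·|M|^{3/2}/√(|K|−1) + |M|` (`≈ √2·|K|^{5/2}`; `subgroupHorn_card_mul_le` with
`borel_secondCharDegree_ge`). [cite: BlasiakCohnGrochowPrattUmans2023, Thm. 3.2] -/
theorem borelHorn_card_mul_le [DecidableEq K] (M : Subgroup (Matrix.SpecialLinearGroup (Fin 2) K))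
    (hM : ∀ g ∈ M, (g : Matrix (Fin 2) (Fin 2) K) 1 0 = 0)
    (hU : ∀ x : K, (⟨_, sl2md_det_upper x⟩ : Matrix.SpecialLinearGroup (Fin 2) K) ∈ M)
    (hT : ∀ c : Kˣ, (⟨_, sl2md_det_diag c⟩ : Matrix.SpecialLinearGroup (Fin 2) K) ∈ M)
    (hK : 4 ≤ Fintype.card K) (X Y Z : Finset (Matrix.SpecialLinearGroup (Fin 2) K))
    (hTPP : Literature.Combinatorics.Additive.TripleProductProperty X Y Z) (hX : ∀ x ∈ X, x ∈ M)
    (hY : ∀ y ∈ Y, ∀ y' ∈ Y, y * y'⁻¹ ∈ M) (hZ : ∀ z ∈ Z, ∀ z' ∈ Z, z * z'⁻¹ ∈ M) :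
    ((X.card * Y.card * Z.card : ℕ) : ℝ) ≤
      Real.sqrt 2 * (Nat.card M : ℝ) ^ (3 / 2 : ℝ) / Real.sqrt ((Fintype.card K : ℝ) - 1) + Nat.card M := by
  have h := subgroupHorn_card_mul_le M X Y Z hTPP hX hY hZ (borel_nonabelian M hU hT hK)
  have hn := borel_secondCharDegree_ge M hM hU hT hK
  set N : ℝ := (Nat.card M : ℝ)
  set n : ℝ := (secondCharDegree M : ℝ)
  have hQ1 : (0 : ℝ) < (Fintype.card K : ℝ) - 1 := by
    have : (4 : ℝ) ≤ Fintype.card K := by exact_mod_cast hK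
    linarith
  have hsq : Real.sqrt ((Fintype.card K : ℝ) - 1) / Real.sqrt 2 ≤ Real.sqrt n := by
    rw [← Real.sqrt_div hQ1.le]; exact Real.sqrt_le_sqrt hn
  have hpos : 0 < Real.sqrt ((Fintype.card K : ℝ) - 1) / Real.sqrt 2 := by positivity
  calc ((X.card * Y.card * Z.card : ℕ) : ℝ) ≤ N ^ (3 / 2 : ℝ) / Real.sqrt n + N := h
    _ ≤ N ^ (3 / 2 : ℝ) / (Real.sqrt ((Fintype.card K : ℝ) - 1) / Real.sqrt 2) + N := by gcongr
    _ = Real.sqrt 2 * N ^ (3 / 2 : ℝ) / Real.sqrt ((Fintype.card K : ℝ) - 1) + N := by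
        rw [div_div_eq_mul_div, mul_comm]

end Borel

end Summit.MatrixMultiplication.MatrixMultiplication.Theorems.GradedDesignFamily.Negative

end
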